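import Mathlib
import Literature.AlgebraicGeometry.Resolution.SubfieldTransport
import Summits.ResolutionOfSingularities.ResolutionOfSingularities.Theorems.AbhyankarShadowsSemivaluationShadowsFrameShadow
import Summits.ResolutionOfSingularities.ResolutionOfSingularities.Theorems.AbhyankarShadowsRationalSuffices
import HarnessLib

/-!
# Helpers for the ruled case over an Abhyankar base (`stub_ruledOverAbhyankarBaseShadows`), II

Crux `SemivaluationShadows` (item `stmt-ResolutionOfSingularities-16757`, route
`ResolutionOfSingularities/AbhyankarShadows`), line `birth`, registered stub
`stub_ruledOverAbhyankarBaseShadows`: **the transfer from an exact evaluation**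
(`RuledAbh.shadow_of_exact_evaluation`). Given the saturation `V ⊇ O` on `M ⊇ K`, a field
`g : L → M` with `O_L = V ∩ L` rational, a `k`-algebra evaluation `ψ : D → M` (`D → K`
injective) which is EXACT (value-preserving, constant-preserving) on the generators `s` of a model
and on `F`, a monomial chart `R_L ⊆ L` with frame `T'` (`frameChart` downstairs) receiving
`ψ(s)`, and EXACT LIFTS `e_j ∈ K` of the `T'_j` (`ψ e_j = T'_j`, same value), the model
`R₁ = k[s, e]` with `φ = ψ|R₁ : R₁ → L` (built on the subalgebra of bi-congruent elements)
satisfies all hypotheses of the frame transfer `frameShadow`,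
whence `HasShadow O R F` (the crux's `∃`-tail, unfolded).

No named facts beyond the tree's are used. [folklore]
-/

-- single-problem summit: the doubled namespace component `ResolutionOfSingularities` is forced
set_option linter.dupNamespace false

noncomputable section

open Literature.AlgebraicGeometry.Resolution

namespace Summit.ResolutionOfSingularities.ResolutionOfSingularities.Theorems

namespace RuledAbh

/-! ## Congruences to constants (private copies of the lemmas of `…Helpers.lean`) -/

section Congruence

variable {k E Γ : Type*} [Field k] [Field E] [Algebra k E] [LinearOrderedCommGroupWithZero Γ]
  (v : Valuation E Γ)

/-- Sums of elements congruent to constants are congruent to the sum of the constants.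
(Private copy of the lemma of `…Helpers.lean`, to decouple the two helper modules.) [folklore] -/
private theorem congAdd_aux {x x' : E} {c c' : k} (h : v (x - algebraMap k E c) < 1)
    (h' : v (x' - algebraMap k E c') < 1) : v (x + x' - algebraMap k E (c + c')) < 1 := by
  rw [map_add, add_sub_add_comm]
  exact v.map_add_lt h h'

/-- Products of elements congruent to constants are congruent to the product of the constants
(constants having value `≤ 1`). (Private copy of the lemma of `…Helpers.lean`, to decouple the two helper modules.) [folklore] -/
private theorem congMul_aux (hk1 : ∀ c : k, v (algebraMap k E c) ≤ 1) {x x' : E} {c c' : k}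
    (h : v (x - algebraMap k E c) < 1) (h' : v (x' - algebraMap k E c') < 1) :
    v (x * x' - algebraMap k E (c * c')) < 1 := by
  have hx : v x ≤ 1 := by
    have := v.map_add_le h.le (hk1 c)
    rwa [sub_add_cancel] at this
  have hrw : x * x' - algebraMap k E (c * c') =
      (x' - algebraMap k E c') * x + (x - algebraMap k E c) * algebraMap k E c' := by
    rw [map_mul]; ring
  rw [hrw]
  refine v.map_add_lt ?_ ?_
  · rw [map_mul]; exact mul_lt_one_of_lt_of_le h' hx
  · rw [map_mul]; exact mul_lt_one_of_lt_of_le h (hk1 c')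

/-- An element congruent to the constant `c` lies in the maximal ideal iff `c = 0` (non-zero
constants having value `1`). (Private copy of the lemma of `…Helpers.lean`, to decouple the two helper modules.) [folklore] -/
private theorem ltOneIff_aux (hk1 : ∀ c : k, c ≠ 0 → v (algebraMap k E c) = 1) {x : E}
    {c : k} (h : v (x - algebraMap k E c) < 1) : v x < 1 ↔ c = 0 := by
  by_cases hc : c = 0
  · rw [hc, map_zero, sub_zero] at h
    exact ⟨fun _ => hc, fun _ => h⟩
  · refine ⟨fun hx => absurd ?_ (lt_irrefl (1 : Γ)), fun h0 => absurd h0 hc⟩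
    calc (1 : Γ) = v (algebraMap k E c) := (hk1 c hc).symm
      _ = v (x - (x - algebraMap k E c)) := by rw [sub_sub_cancel]
      _ < 1 := v.map_sub_lt hx h

end Congruence

/-- **Lifting a homomorphism through an injection.** If `g : L → M` is injective, compatible
with the constants, and `f : A → M` takes values in its range, then `f = g ∘ φ` for a
`k`-algebra map `φ : A → L`. (Private copy of `RuledAbh.exists_algHom_lift`.) [folklore] -/
private theorem algHomLift_aux {k A L M : Type*} [CommSemiring k] [Semiring A] [Algebra k A]
    [Semiring L] [Algebra k L] [Semiring M] [Algebra k M] (f : A →ₐ[k] M) (g : L →+* M)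
    (hg : Function.Injective g) (hgk : ∀ c : k, g (algebraMap k L c) = algebraMap k M c)
    (h : ∀ a, ∃ v : L, g v = f a) : ∃ φ : A →ₐ[k] L, ∀ a, g (φ a) = f a := by
  choose v hv using h
  refine ⟨{ toFun := v
            map_one' := hg (by rw [hv, map_one, map_one])
            map_mul' := fun a b => hg (by rw [hv, map_mul, map_mul, hv, hv])
            map_zero' := hg (by rw [hv, map_zero, map_zero])
            map_add' := fun a b => hg (by rw [hv, map_add, map_add, hv, hv])
            commutes' := fun c => hg (by rw [hv, hgk, AlgHom.commutes]) }, fun a => hv a⟩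

/-- **The subalgebra of bi-congruent elements.** For valuations `v_K` on `K` and `v_M` on `M`
(constants of value `≤ 1`), a `k`-algebra `D` with maps `val : D → K`, `ψ : D → M`, a map
`g : L → M` compatible with constants and a `k`-subalgebra `R_L ⊆ L`: the elements `x = val w`
of `K` such that `ψ w ∈ g(R_L)` and `x`, `ψ w` are congruent to ONE AND THE SAME constant
modulo the two maximal ideals form a `k`-subalgebra of `K`. (Private copy of
`RuledAbh.exists_goodSubalgebra`.) [folklore] -/
private theorem goodSubalgebra_aux {k K L M Dt : Type*} [Field k] [Field K] [Algebra k K] [Field L]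
    [Algebra k L] [Field M] [Algebra k M] [CommRing Dt] [Algebra k Dt]
    {ΓK ΓM : Type*} [LinearOrderedCommGroupWithZero ΓK] [LinearOrderedCommGroupWithZero ΓM]
    (vK : Valuation K ΓK) (vM : Valuation M ΓM) (hk1 : ∀ c : k, vK (algebraMap k K c) ≤ 1)
    (hk1' : ∀ c : k, vM (algebraMap k M c) ≤ 1) (val : Dt →ₐ[k] K) (ψ : Dt →ₐ[k] M)
    (g : L →+* M) (hgk : ∀ c : k, g (algebraMap k L c) = algebraMap k M c)
    (RL : Subalgebra k L) :
    ∃ A : Subalgebra k K, ∀ x : K, x ∈ A ↔ ∃ w : Dt, val w = x ∧ (∃ u ∈ RL, g u = ψ w) ∧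
      ∃ a : k, vK (x - algebraMap k K a) < 1 ∧ vM (ψ w - algebraMap k M a) < 1 := by
  have hconst : ∀ a : k, ∃ w : Dt, val w = algebraMap k K a ∧ (∃ u ∈ RL, g u = ψ w) ∧
      ∃ a' : k, vK (algebraMap k K a - algebraMap k K a') < 1 ∧
        vM (ψ w - algebraMap k M a') < 1 := fun a =>
    ⟨algebraMap k Dt a, val.commutes a, ⟨algebraMap k L a, RL.algebraMap_mem a,
      by rw [hgk, ψ.commutes]⟩, a, by rw [sub_self, map_zero]; exact zero_lt_one,
      by rw [ψ.commutes, sub_self, map_zero]; exact zero_lt_one⟩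
  refine ⟨{ carrier := {x | ∃ w : Dt, val w = x ∧ (∃ u ∈ RL, g u = ψ w) ∧
              ∃ a : k, vK (x - algebraMap k K a) < 1 ∧ vM (ψ w - algebraMap k M a) < 1}
            mul_mem' := ?_
            one_mem' := by simpa using hconst 1
            add_mem' := ?_
            zero_mem' := by simpa using hconst 0
            algebraMap_mem' := hconst }, fun _ => Iff.rfl⟩
  · rintro _ _ ⟨w, rfl, ⟨u, hu, hgu⟩, a, ha, ha'⟩ ⟨w', rfl, ⟨u', hu', hgu'⟩, a', hb, hb'⟩
    refine ⟨w * w', by rw [map_mul], ⟨u * u', RL.mul_mem hu hu',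
      by rw [map_mul, map_mul, hgu, hgu']⟩, a * a', congMul_aux vK hk1 ha hb, ?_⟩
    rw [map_mul]
    exact congMul_aux vM hk1' ha' hb'
  · rintro _ _ ⟨w, rfl, ⟨u, hu, hgu⟩, a, ha, ha'⟩ ⟨w', rfl, ⟨u', hu', hgu'⟩, a', hb, hb'⟩
    refine ⟨w + w', by rw [map_add], ⟨u + u', RL.add_mem hu hu',
      by rw [map_add, map_add, hgu, hgu']⟩, a + a', congAdd_aux vK ha hb, ?_⟩
    rw [map_add]
    exact congAdd_aux vM ha' hb'

/-! ## The transfer from an exact evaluation -/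

/-- **Shadows from an exact evaluation with a monomial chart downstairs.** Data: a rational
valuation ring `O ∋ k` of `K` of rational rank `r`, its saturation `V` on `M ⊇ K` (`V ∩ K = O`,
residues of units constants), a field `g : L → M` with `O_L = V ∩ L`, a `k`-algebra `D` over
`K` (`val : D → K` injective) with an evaluation `ψ : D → M`, a finite set `s ⊆ K` generating a
model of `K` containing `R`, a monomial chart `R_L ⊆ L` (`Frac R_L = L`) with frame `T'`
(non-zero, in `R_L`, values `< 1` and `ℤ`-independent; every non-zero element of `R_L` has
value `∏ v(T'ⱼ)^{mⱼ}`, `m ∈ ℕʳ`), such that: each `x ∈ s` is `val w` with `ψ w ∈ g(R_L)` and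
`x`, `ψ w` congruent to the same constant; `e : Fin r → K` are EXACT LIFTS of `T'`
(`ψ eⱼ = g T'ⱼ`, `V(g T'ⱼ) = V(eⱼ)`); and `ψ` is exact on `F`. Then `HasShadow O R F` (the
crux's `∃`-tail, unfolded): the model is `R₁ = k[s, e]`, the map `φ = ψ|R₁` corestricted to
`L`, the frame `e ↦ T'`, and the eight clauses follow from `frameShadow`. [folklore] -/
theorem shadow_of_exact_evaluation (k K M L Dt : Type) [Field k] [Field K] [Algebra k K]
    [Field M] [Algebra K M] [Algebra k M] [IsScalarTower k K M] [Field L] [Algebra k L]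
    [CommRing Dt] [Algebra k Dt]
    (O : ValuationSubring K) (hk : ∀ c : k, algebraMap k K c ∈ O)
    (hrat : ∀ x : K, x ∈ O → ∃ c : k, O.valuation (x - algebraMap k K c) < 1) (r : ℕ)
    (hrr : Module.finrank ℤ (Additive (O.ValueGroup)ˣ) = r)
    (V : ValuationSubring M) (hVO : V.comap (algebraMap K M) = O)
    (hres : ∀ u : M, V.valuation u = 1 → ∃ c : k, V.valuation (u - algebraMap k M c) < 1)
    (g : L →+* M) (hgk : ∀ c : k, g (algebraMap k L c) = algebraMap k M c)
    (OL : ValuationSubring L) (hOL : V.comap g = OL)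
    (val : Dt →ₐ[k] K) (hval : Function.Injective val) (ψ : Dt →ₐ[k] M)
    (R : Subalgebra k K) (s : Finset K) (hRs : R ≤ Algebra.adjoin k (s : Set K))
    (hfracs : IsFractionRing (Algebra.adjoin k (s : Set K)) K)
    (RL : Subalgebra k L) (hfracL : IsFractionRing RL L)
    (T' : Fin r → L) (hT'0 : ∀ j, T' j ≠ 0) (hT'R : ∀ j, T' j ∈ RL)
    (hT'lt : ∀ j, OL.valuation (T' j) < 1)
    (hT'ind : ∀ m : Fin r → ℤ, (∏ j, OL.valuation (T' j) ^ (m j)) = 1 → m = 0)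
    (hmono : ∀ a : L, a ∈ RL → a ≠ 0 →
      ∃ m : Fin r → ℕ, OL.valuation a = ∏ j, OL.valuation (T' j) ^ (m j))
    (hs : ∀ x ∈ s, ∃ w : Dt, val w = x ∧ (∃ u ∈ RL, g u = ψ w) ∧
      ∃ a : k, O.valuation (x - algebraMap k K a) < 1 ∧ V.valuation (ψ w - algebraMap k M a) < 1)
    (e : Fin r → K) (he : ∀ j, ∃ w : Dt, val w = e j ∧ ψ w = g (T' j))
    (heex : ∀ j, V.valuation (g (T' j)) = V.valuation (algebraMap K M (e j)))
    (F : Finset R)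
    (hF : ∀ x ∈ F, ∃ w : Dt, val w = ((x : R) : K) ∧
      V.valuation (ψ w) = V.valuation (algebraMap K M ((x : R) : K))) :
    ∃ (R₁ : Subalgebra k K) (hle : R ≤ R₁) (_ : R₁.toSubring ≤ O.toSubring), R₁.FG ∧
    IsFractionRing R₁ K ∧ ∃ (L : Type) (_ : Field L) (_ : Algebra k L) (φ : R₁ →ₐ[k] L)
    (O' : ValuationSubring L), Module.finrank ℤ (Additive (O'.ValueGroup)ˣ) =
      Module.finrank ℤ (Additive (O.ValueGroup)ˣ) ∧ (∀ y : R₁, φ y ∈ O') ∧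
    (∀ y : R₁, O'.valuation (φ y) < 1 ↔ O.valuation (y : K) < 1) ∧
    (∀ z : L, z ∈ O' → ∃ c : k, O'.valuation (z - algebraMap k L c) < 1) ∧
    (MonoidHom.mrange (O'.valuation.toMonoidWithZeroHom.toMonoidHom.comp
      φ.toRingHom.toMonoidHom)).FG ∧
    ∃ ι : O'.ValueGroup →*₀o O.ValueGroup, Function.Injective ι ∧
      (∀ y : R₁, φ y ≠ 0 → ∃ y' : R₁, ι (O'.valuation (φ y)) = O.valuation (y' : K)) ∧
      ∀ x ∈ F, ι (O'.valuation (φ (Subalgebra.inclusion hle x))) = O.valuation ((x : R) : K) := by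
  classical
  -- constants
  have hkO1 : ∀ c : k, O.valuation (algebraMap k K c) ≤ 1 := fun c =>
    (O.valuation_le_one_iff _).mpr (hk c)
  have hkV : ∀ c : k, algebraMap k M c ∈ V := fun c => by
    have h := hk c
    rw [← hVO, ValuationSubring.mem_comap, ← IsScalarTower.algebraMap_apply] at h
    exact h
  have hkV1 : ∀ c : k, V.valuation (algebraMap k M c) ≤ 1 := fun c =>
    (V.valuation_le_one_iff _).mpr (hkV c)
  have hkOL : ∀ c : k, algebraMap k L c ∈ OL := fun c => by
    rw [← hOL, ValuationSubring.mem_comap, hgk]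
    exact hkV c
  have hg : Function.Injective g := g.injective
  -- comparisons along `g` and along `K → M`
  have hLlt : ∀ z : L, OL.valuation z < 1 ↔ V.valuation (g z) < 1 := fun z =>
    (valuation_map_lt_one_iff g hOL z).symm
  have hLeq : ∀ z z' : L, OL.valuation z = OL.valuation z' ↔
      V.valuation (g z) = V.valuation (g z') := fun z z' => (valuation_map_eq_iff g hOL z z').symm
  have hKeq : ∀ x x' : K, O.valuation x = O.valuation x' ↔
      V.valuation (algebraMap K M x) = V.valuation (algebraMap K M x') := fun x x' =>
    (valuation_map_eq_iff (algebraMap K M) hVO x x').symm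
  have hprodV : ∀ m : Fin r → ℤ, V.valuation (g (∏ j, T' j ^ m j)) =
      V.valuation (algebraMap K M (∏ j, e j ^ m j)) := fun m => by
    simp only [map_prod, map_zpow₀, heex]
  -- the good subalgebra and the model `R₁ = k[s, e]`
  obtain ⟨A, hA⟩ := goodSubalgebra_aux O.valuation V.valuation hkO1 hkV1 val ψ g hgk RL
  have hsA : ∀ x ∈ s, x ∈ A := fun x hx => (hA x).mpr (hs x hx)
  have heA : ∀ j, e j ∈ A := fun j => by
    obtain ⟨w, hw, hψw⟩ := he j
    refine (hA _).mpr ⟨w, hw, ⟨T' j, hT'R j, hψw.symm⟩, 0, ?_, ?_⟩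
    · rw [map_zero, sub_zero, ← valuation_map_lt_one_iff (algebraMap K M) hVO, ← heex, ← hLlt]
      exact hT'lt j
    · rw [map_zero, sub_zero, hψw, ← hLlt]
      exact hT'lt j
  set G : Finset K := s ∪ Finset.univ.image e with hG
  set R₁ : Subalgebra k K := Algebra.adjoin k (G : Set K) with hR₁
  have hR₁A : R₁ ≤ A := by
    refine Algebra.adjoin_le fun x hx => ?_
    rcases Finset.mem_union.mp (Finset.mem_coe.mp hx) with hx | hx
    · exact hsA x hx
    · obtain ⟨j, -, rfl⟩ := Finset.mem_image.mp hx
      exact heA j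
  have hsR₁ : Algebra.adjoin k (s : Set K) ≤ R₁ :=
    Algebra.adjoin_mono fun x hx => Finset.mem_coe.mpr (Finset.mem_union_left _ hx)
  have hle : R ≤ R₁ := hRs.trans hsR₁
  have heR₁ : ∀ j, e j ∈ R₁ := fun j => Algebra.subset_adjoin
    (Finset.mem_coe.mpr (Finset.mem_union_right _ (Finset.mem_image.mpr ⟨j, Finset.mem_univ _, rfl⟩)))
  have h₁O : R₁.toSubring ≤ O.toSubring := by
    intro x hx
    obtain ⟨-, -, -, a, ha, -⟩ := (hA x).mp (hR₁A hx)
    have h := O.valuation.map_add_le ha.le (hkO1 a)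
    rw [sub_add_cancel] at h
    exact (O.valuation_le_one_iff _).mp h
  have hfg₁ : R₁.FG := ⟨G, rfl⟩
  have hfrac : IsFractionRing R₁ K := by
    haveI := hfracs
    exact IsFractionRing.of_field R₁ K fun z => by
      obtain ⟨a, b, -, hab⟩ := IsFractionRing.div_surjective (A := Algebra.adjoin k (s : Set K)) z
      exact ⟨⟨a, hsR₁ a.2⟩, ⟨b, hsR₁ b.2⟩, hab.symm⟩
  -- the evaluation on `R₁`: `R₁ → D → M`, corestricted to `L`
  obtain ⟨incl, hincl⟩ : ∃ incl : R₁ →ₐ[k] Dt, ∀ z, val (incl z) = (z : K) :=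
    algHomLift_aux R₁.val (val : Dt →+* K) (fun a b h => hval h) (fun c => val.commutes c)
      fun z => by
        obtain ⟨w, hw, -⟩ := (hA z).mp (hR₁A z.2)
        exact ⟨w, hw⟩
  have hψ₁ : ∀ z : R₁, (∃ u ∈ RL, g u = ψ (incl z)) ∧ ∃ a : k,
      O.valuation ((z : K) - algebraMap k K a) < 1 ∧
        V.valuation (ψ (incl z) - algebraMap k M a) < 1 := by
    intro z
    obtain ⟨w, hw, hv, ha⟩ := (hA z).mp (hR₁A z.2)
    have hwz : w = incl z := hval (by rw [hw, hincl])
    subst hwz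
    exact ⟨hv, ha⟩
  obtain ⟨φL, hφL⟩ : ∃ φL : R₁ →ₐ[k] L, ∀ z, g (φL z) = (ψ.comp incl) z :=
    algHomLift_aux (ψ.comp incl) g hg hgk fun z => by
      obtain ⟨⟨u, -, hu⟩, -⟩ := hψ₁ z
      exact ⟨u, hu⟩
  have hφL' : ∀ z, g (φL z) = ψ (incl z) := fun z => hφL z
  have hφLR : ∀ z : R₁, φL z ∈ RL := fun z => by
    obtain ⟨⟨u, hu, hgu⟩, -⟩ := hψ₁ z
    rwa [← hg (hgu.trans (hφL' z).symm)]
  -- the frame upstairs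
  set eR : Fin r → R₁ := fun j => ⟨e j, heR₁ j⟩ with heR
  have heRK : ∀ j, ((eR j : R₁) : K) = e j := fun j => rfl
  have hφLe : ∀ j, φL (eR j) = T' j := fun j => by
    obtain ⟨w, hw, hψw⟩ := he j
    apply hg
    rw [hφL']
    have h1 : incl (eR j) = w := hval (by rw [hincl, hw])
    rw [h1, hψw]
  -- [inside], [centre], [rational']
  have hkL1 : ∀ a : k, a ≠ 0 → OL.valuation (algebraMap k L a) = 1 := fun a ha =>
    valuation_algebraMap_eq_one OL hkOL ha
  have hin : ∀ z : R₁, φL z ∈ OL := fun z => by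
    obtain ⟨-, a, -, ha'⟩ := hψ₁ z
    rw [← hOL, ValuationSubring.mem_comap, hφL', ← V.valuation_le_one_iff]
    have h := V.valuation.map_add_le ha'.le (hkV1 a)
    rwa [sub_add_cancel] at h
  have hcen : ∀ z : R₁, OL.valuation (φL z) < 1 ↔ O.valuation (z : K) < 1 := fun z => by
    obtain ⟨-, a, ha, ha'⟩ := hψ₁ z
    have ha'' : OL.valuation (φL z - algebraMap k L a) < 1 := by
      rw [hLlt, map_sub, hφL', hgk]
      exact ha'
    rw [ltOneIff_aux OL.valuation hkL1 ha'',
      ltOneIff_aux O.valuation (fun a ha => valuation_algebraMap_eq_one O hk ha) ha]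
  have hrat' : ∀ z : L, z ∈ OL → ∃ a : k, OL.valuation (z - algebraMap k L a) < 1 := by
    intro z hz
    rw [← hOL, ValuationSubring.mem_comap] at hz
    have hz1 : V.valuation (g z) ≤ 1 := (V.valuation_le_one_iff _).mpr hz
    rcases hz1.lt_or_eq with hlt | h1
    · exact ⟨0, by rwa [map_zero, sub_zero, hLlt]⟩
    · obtain ⟨a, ha⟩ := hres _ h1
      exact ⟨a, by rwa [hLlt, map_sub, hgk]⟩
  -- the frame hypotheses of `frameShadow`
  have he0 : ∀ j, ((eR j : R₁) : K) ≠ 0 := fun j h => by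
    have h1 := heex j
    rw [heRK] at h
    rw [h, map_zero, map_zero, map_eq_zero] at h1
    exact hT'0 j (hg (by rw [h1, map_zero]))
  have heφ : ∀ j, φL (eR j) ≠ 0 := fun j => by
    rw [hφLe]
    exact hT'0 j
  have hvT'0 : ∀ j, OL.valuation (T' j) ≠ 0 := fun j => (map_ne_zero _).mpr (hT'0 j)
  have hmonoL : ∀ m : Fin r → ℤ, (∏ j, OL.valuation (φL (eR j)) ^ m j) =
      OL.valuation (∏ j, T' j ^ m j) := fun m => by
    rw [map_prod]
    exact Finset.prod_congr rfl fun j _ => by rw [map_zpow₀, hφLe]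
  have hmonoK : ∀ m : Fin r → ℤ, (∏ j, O.valuation ((eR j : R₁) : K) ^ m j) =
      O.valuation (∏ j, e j ^ m j) := fun m => by
    rw [map_prod]
    exact Finset.prod_congr rfl fun j _ => by rw [map_zpow₀, heRK]
  have hgen' : ∀ z : L, z ≠ 0 →
      ∃ m : Fin r → ℤ, OL.valuation z = ∏ j, OL.valuation (φL (eR j)) ^ m j := by
    intro z hz
    haveI := hfracL
    obtain ⟨a, b, -, rfl⟩ := IsFractionRing.div_surjective (A := RL) z
    have ha0 : (a : L) ≠ 0 := fun h => hz (by
      rw [show algebraMap RL L a = (a : L) from rfl, h, zero_div])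
    have hb0 : (b : L) ≠ 0 := fun h => hz (by
      rw [show algebraMap RL L b = (b : L) from rfl, h, div_zero])
    obtain ⟨ma, hma⟩ := hmono a a.2 ha0
    obtain ⟨mb, hmb⟩ := hmono b b.2 hb0
    refine ⟨fun j => (ma j : ℤ) - mb j, ?_⟩
    rw [show algebraMap RL L a = (a : L) from rfl, show algebraMap RL L b = (b : L) from rfl,
      map_div₀, hma, hmb, div_eq_iff (Finset.prod_ne_zero_iff.mpr fun j _ => pow_ne_zero _ (hvT'0 j)),
      ← Finset.prod_mul_distrib]
    refine Finset.prod_congr rfl fun j _ => ?_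
    rw [hφLe, ← zpow_natCast, ← zpow_natCast, ← zpow_add₀ (hvT'0 j), sub_add_cancel]
  have hind : ∀ m : Fin r → ℤ, (∏ j, O.valuation ((eR j : R₁) : K) ^ m j) = 1 → m = 0 := by
    intro m hm
    apply hT'ind
    rw [hmonoK, ← map_one O.valuation, hKeq, ← hprodV, map_one, map_one,
      valuation_map_eq_one_iff g hOL, map_prod] at hm
    simpa only [map_zpow₀] using hm
  have hord : ∀ m : Fin r → ℤ, (∏ j, OL.valuation (φL (eR j)) ^ m j) ≤ 1 ↔
      (∏ j, O.valuation ((eR j : R₁) : K) ^ m j) ≤ 1 := fun m => by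
    rw [hmonoL, hmonoK, OL.valuation_le_one_iff, O.valuation_le_one_iff, ← hOL, ← hVO,
      ValuationSubring.mem_comap, ValuationSubring.mem_comap, ← V.valuation_le_one_iff,
      ← V.valuation_le_one_iff, hprodV]
  have h5 : ∀ z : R₁, φL z ≠ 0 →
      ∃ m : Fin r → ℕ, OL.valuation (φL z) = ∏ j, OL.valuation (φL (eR j)) ^ m j := by
    intro z hz
    obtain ⟨m, hm⟩ := hmono (φL z) (hφLR z) hz
    exact ⟨m, by rw [hm]; exact Finset.prod_congr rfl fun j _ => by rw [hφLe]⟩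
  have hexF : ∀ x ∈ F, ((x : R) : K) ≠ 0 → φL (Subalgebra.inclusion hle x) ≠ 0 ∧
      ∃ m : Fin r → ℤ, OL.valuation (φL (Subalgebra.inclusion hle x)) =
        ∏ j, OL.valuation (φL (eR j)) ^ m j ∧
        O.valuation ((x : R) : K) = ∏ j, O.valuation ((eR j : R₁) : K) ^ m j := by
    intro x hxF hx0
    obtain ⟨w, hw, hwex⟩ := hF x hxF
    have h1 : incl (Subalgebra.inclusion hle x) = w := hval (by rw [hincl, hw]; rfl)
    have hxV : V.valuation (g (φL (Subalgebra.inclusion hle x))) =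
        V.valuation (algebraMap K M ((x : R) : K)) := by
      rw [hφL', h1, hwex]
    have hne : φL (Subalgebra.inclusion hle x) ≠ 0 := fun h0 => by
      rw [h0, map_zero, map_zero, eq_comm, map_eq_zero, map_eq_zero] at hxV
      exact hx0 hxV
    obtain ⟨m, hm⟩ := hgen' _ hne
    refine ⟨hne, m, hm, ?_⟩
    rw [hmonoK, hKeq, ← hprodV, ← hxV, ← hLeq, hm, hmonoL]
  exact frameShadow k K O hk hrat r hrr R R₁ hle h₁O hfg₁ hfrac L φL OL hin hcen hrat' eR he0 heφ
    hgen' hind hord h5 F hexF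

end RuledAbh

end Summit.ResolutionOfSingularities.ResolutionOfSingularities.Theorems

end
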